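import Literature.AlgebraicGeometry.GroupSchemes.ConnectedOfOnePointSpecialFibre
import Literature.AlgebraicGeometry.GroupSchemes.ConnectedFactorsThroughUnitComponent
import Literature.AlgebraicGeometry.GroupSchemes.UnitComponentOfFiniteGroupScheme
import Literature.AlgebraicGeometry.Morphisms.ClosedImmersionOfEqualRank
import HarnessLib

/-!
# The canonical line of a unit component: a closed subgroup with one-point special fibre lies in `G⁰`

Topic `Literature/AlgebraicGeometry/GroupSchemes`; namespace `Literature.AlgebraicGeometry.GroupSchemes.UnitComponent`.  THEOREMS ONLY (no definition,
no named fact, no instance, no notation, no `sorry`).  Cell `hodgecm-mathlib` (D-0151), FLOOR 0, P6 «MOD programme» (crux hLiu418 =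
stmt-HodgeConjecture-24832, `--supports`): brick **(E-b4′) «CANONICAL LINE ENGINE»** of desk F0P6b-plan (g0) (BRICK TEXT v1, 2026-09-01) — the one P6b-currency
input of the DICT letter (b4′) `canonicalLine` («at an ordinary reduction exactly one line specialises to the Frobenius kernel»), POINTS route:
over a LOCAL base `R` (the heart: `R = 𝒪_Ω`, a henselian valuation ring), for a finite group scheme `G` with a unit component `j : G₀ ↪ G` and a closed
subgroup `c : C ↪ G` whose special fibre has EXACTLY ONE point — (U1) `c` factors through `j` by a closed immersion of group schemes; (U2) if moreover
`G`, `C` are flat and `rank C = rank G₀` at the closed point, the factor is an isomorphism `C ≅ G₀` over `G`; (U3) if `C` and `G₀` have the same finite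
number of sections, the sections of `G` through `C` are exactly the sections through `G₀` («`L = L₀`», the uniqueness clause of (b4′)).  NO moduli, NO
`𝒪`-action, NO Frobenius; `R` only LOCAL (henselian is not needed for (U1)–(U3); the henselian heart applies them verbatim).  HC_CM is proved only modulo
the printed citations until rung 0 closes; this file is generic and changes no count.

THE PRINT.  [Tate1997FiniteFlatGroupSchemes] (3.7): over a henselian local base a finite flat group scheme has a connected–étale sequence
`0 → G⁰ → G → G^ét → 0`; `G⁰` is the connected component of the unit section, open and closed in `G`; a CONNECTED closed subgroup scheme lies in
`G⁰`, and `G⁰(R)` is the kernel of reduction on points.  Here: a closed subgroup `C ↪ G` (finite over the local `R`) whose special fibre is one point is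
connected (★ (O-b1h) `UnitComponent.connectedSpace_of_natCard_specialFibre_eq_one`: `Γ(C)` is module-finite over `R` with a single maximal ideal, hence
local, [AtiyahMacdonald1969] Cor. 5.8), so the homomorphism `c` factors uniquely through the open-and-closed unit component (★ (o-c2d)
`existsUnique_fac_hom`); the factor is a homomorphism (★ `isMonHom_of_comp`) and a closed immersion (Mathlib `IsClosedImmersion.of_comp_isClosedImmersion`).
With flatness and equal closed-point rank it is an isomorphism ([StacksProject] Tag 02KA in the tree's local form ★
`Morphisms.isIso_of_isClosedImmersion_of_finrank_closedPoint_eq`).  [Katz1973] Thm. 3.1 ∕ 3.10.7: the canonical subgroup of an ordinary curve is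
`Ĝ[p]`, characterised by connectedness — (U3) is the section-level uniqueness the dictionary consumes.  [SerreTate1968] §1 Lemma 1 (reduction on points).

* §1 (U1) `exists_fac_unitComponent_of_natCard_specialFibre_eq_one` (+ the unique form `existsUnique_fac_unitComponent_of_natCard_specialFibre_eq_one`).
* §2 (U2) `isIso_fac_unitComponent_of_finrank_closedPoint_eq` (`∃ φ : C ≅ G₀, φ.hom ≫ j = c`).
* §3 (U3) `range_comp_subset_range_unitComponent_of_natCard_specialFibre_eq_one` (`⊆`, no count needed) and
  `range_comp_eq_range_unitComponent_of_natCard_specialFibre_eq_one` (`=`, under `#C(R) = #G₀(R)` finite).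

## References
* [Tate1997FiniteFlatGroupSchemes] J. Tate, *Finite flat group schemes*, in: Modular Forms and Fermat's Last Theorem (1997), (3.7).
* [StacksProject] The Stacks Project, Tag 02KA (finite flat of equal rank + closed immersion ⇒ isomorphism), Tag 04GG (points of the special fibre).
* [AtiyahMacdonald1969] M. Atiyah, I. Macdonald, *Introduction to Commutative Algebra* (1969), Cor. 5.8 (p. 61).
* [Katz1973] N. Katz, *p-adic properties of modular schemes and modular forms*, LNM 350 (1973), Thm. 3.1 and 3.10.7 (canonical subgroup).
* [SerreTate1968] J.-P. Serre, J. Tate, *Good reduction of abelian varieties*, Ann. of Math. 88 (1968), §1 Lemma 1.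
-/

set_option autoImplicit false

universe u

open CategoryTheory Limits MonoidalCategory CartesianMonoidalCategory AlgebraicGeometry

noncomputable section

namespace Literature.AlgebraicGeometry.GroupSchemes.UnitComponent

open Literature.AlgebraicGeometry.Morphisms
open scoped MonObj

variable (R : Type u) [CommRing R] [IsLocalRing R] (G G₀ : Over (Spec (.of R))) [GrpObj G] [GrpObj G₀] (j : G₀ ⟶ G)
  (hG : IsFinite G.hom) (hj : IsMonHom j ∧ IsOpenImmersion j.left ∧ IsClosedImmersion j.left ∧ ConnectedSpace ↥G₀.left)
  (C : Over (Spec (.of R))) [GrpObj C] (c : C ⟶ G) [IsMonHom c] [IsClosedImmersion c.left]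
  (h1 : Nat.card {x : C.left // C.hom.base x = IsLocalRing.closedPoint R} = 1)

/-! ## §1 (U1) factorisation through the unit component -/

include hG hj h1 in
/-- **(U1) A CLOSED SUBGROUP WITH ONE-POINT SPECIAL FIBRE LIES IN THE UNIT COMPONENT.**  `R` local, `G → Spec R` a finite group scheme with a unit
component `j : G₀ ↪ G` (homomorphism, open and closed immersion, `G₀` connected), `c : C ↪ G` a closed subgroup scheme whose special fibre
`{x ∈ C ∣ x ↦ 𝔪_R}` has exactly one point.  Then `c = f ≫ j` for a homomorphism `f : C → G₀` which is a closed immersion: `C` is finite over `R` with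
one-point special fibre, hence connected (★ (O-b1h)), so `c` factors through the open-and-closed `j` (★ (o-c2d) `existsUnique_fac_hom`).
[cite: Tate1997FiniteFlatGroupSchemes, (3.7)] [cite: AtiyahMacdonald1969, Cor. 5.8 (p. 61)] [cite: StacksProject, Tag 04GG] -/
theorem exists_fac_unitComponent_of_natCard_specialFibre_eq_one :
    ∃ f : C ⟶ G₀, f ≫ j = c ∧ IsMonHom f ∧ IsClosedImmersion f.left := by
  obtain ⟨hmon, hop, hcl, -⟩ := hj
  haveI := hmon; haveI := hop; haveI := hcl; haveI := hG
  haveI : IsFinite C.hom := by rw [← Over.w c]; infer_instance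
  haveI : ConnectedSpace ↥C.left := connectedSpace_of_natCard_specialFibre_eq_one R C inferInstance h1
  haveI : Nonempty ↥(𝟙_ (Over (Spec (.of R)))).left := inferInstanceAs (Nonempty (PrimeSpectrum R))
  obtain ⟨f, hf, -⟩ := existsUnique_fac_hom j c
  haveI : Mono j := Over.mono_of_mono_left j
  haveI : IsMonHom (f ≫ j) := by rw [hf]; infer_instance
  haveI : IsClosedImmersion (f.left ≫ j.left) := by rw [← Over.comp_left, hf]; infer_instance
  exact ⟨f, hf, isMonHom_of_comp j f, IsClosedImmersion.of_comp_isClosedImmersion f.left j.left⟩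

include hG hj h1 in
/-- (U1), unique form: the factorisation `f ≫ j = c` is unique (`j` is a monomorphism), and the factor is a homomorphism and a closed immersion.
[cite: Tate1997FiniteFlatGroupSchemes, (3.7)] -/
theorem existsUnique_fac_unitComponent_of_natCard_specialFibre_eq_one :
    (∃! f : C ⟶ G₀, f ≫ j = c) ∧ ∀ f : C ⟶ G₀, f ≫ j = c → IsMonHom f ∧ IsClosedImmersion f.left := by
  obtain ⟨f, hf, hmonf, hclf⟩ := exists_fac_unitComponent_of_natCard_specialFibre_eq_one R G G₀ j hG hj C c h1
  haveI : IsClosedImmersion j.left := hj.2.2.1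
  haveI : Mono j := Over.mono_of_mono_left j
  have huniq : ∀ f' : C ⟶ G₀, f' ≫ j = c → f' = f := fun f' hf' => (cancel_mono j).mp (hf'.trans hf.symm)
  refine ⟨⟨f, hf, huniq⟩, fun f' hf' => ?_⟩
  obtain rfl := huniq f' hf'
  exact ⟨hmonf, hclf⟩

/-! ## §2 (U2) the iso form under flatness and equal closed-point rank -/

include hG hj h1 in
/-- **(U2) … AND IS THE UNIT COMPONENT WHEN FLAT OF THE SAME RANK.**  If moreover `G` and `C` are flat over `R` and `rank C = rank G₀` at the closed point,
the factor of (U1) is an isomorphism: there is `φ : C ≅ G₀` with `φ.hom ≫ j = c` (equal-rank rigidity over a local base, ★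
`Morphisms.isIso_of_isClosedImmersion_of_finrank_closedPoint_eq`; `G₀` is finite flat as an open-and-closed part of `G`).  FALSE without `Flat C.hom`.
[cite: StacksProject, Tag 02KA] [cite: Tate1997FiniteFlatGroupSchemes, (3.7)] -/
theorem isIso_fac_unitComponent_of_finrank_closedPoint_eq (hGfl : Flat G.hom) (hCfl : Flat C.hom)
    (hrk : C.hom.finrank (IsLocalRing.closedPoint R) = G₀.hom.finrank (IsLocalRing.closedPoint R)) :
    ∃ φ : C ≅ G₀, φ.hom ≫ j = c := by
  obtain ⟨f, hf, -, hclf⟩ := exists_fac_unitComponent_of_natCard_specialFibre_eq_one R G G₀ j hG hj C c h1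
  obtain ⟨-, hop, hcl, -⟩ := hj
  haveI := hop; haveI := hcl; haveI := hG; haveI := hclf
  haveI : IsFinite G₀.hom := (isFinite_and_flat_of_immersions j).1
  haveI : Flat G₀.hom := (isFinite_and_flat_of_immersions j).2 hGfl
  have hw : f.left ≫ G₀.hom = C.hom := Over.w f
  haveI : Flat (f.left ≫ G₀.hom) := by rw [hw]; exact hCfl
  haveI : IsIso f.left :=
    isIso_of_isClosedImmersion_of_finrank_closedPoint_eq f.left G₀.hom (by rw [hw]; exact hrk)
  haveI : IsIso ((Over.forget _).map f) := by simpa using (inferInstance : IsIso f.left)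
  haveI : IsIso f := isIso_of_reflects_iso f (Over.forget _)
  exact ⟨asIso f, hf⟩

/-! ## §3 (U3) the sections through `C` are the sections through `G₀` -/

include hG hj h1 in
/-- **(U3), inclusion**: every section of `G` through the one-point-special-fibre closed subgroup `C` is a section through the unit component `G₀`
(`s ≫ c = (s ≫ f) ≫ j` with `f` from (U1)).  No count needed. [cite: Tate1997FiniteFlatGroupSchemes, (3.7)] [cite: SerreTate1968, §1 Lemma 1] -/
theorem range_comp_subset_range_unitComponent_of_natCard_specialFibre_eq_one :
    Set.range (fun s : 𝟙_ (Over (Spec (.of R))) ⟶ C => s ≫ c) ⊆ Set.range (fun s₀ : 𝟙_ (Over (Spec (.of R))) ⟶ G₀ => s₀ ≫ j) := by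
  obtain ⟨f, hf, -, -⟩ := exists_fac_unitComponent_of_natCard_specialFibre_eq_one R G G₀ j hG hj C c h1
  rintro _ ⟨s, rfl⟩
  exact ⟨s ≫ f, show (s ≫ f) ≫ j = s ≫ c by rw [Category.assoc, hf]⟩

include hG hj h1 in
/-- **(U3) THE CANONICAL LINE: `L = L₀`.**  If `C` and `G₀` have the same finite number of `R`-sections, the sections of `G` through `C` are EXACTLY
the sections through `G₀`: `{s ≫ c} = {s₀ ≫ j}` — both section maps are injective (`c`, `j` are monomorphisms over `Spec R`), the left range lies
in the right one by (U1), and the two finite ranges have the same cardinality.  DICT (b4′): a line `L` whose closure specialises to the Frobenius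
kernel equals the canonical line `L₀ = G₀(R)`. [cite: Katz1973, Thm. 3.1 and 3.10.7] [cite: Tate1997FiniteFlatGroupSchemes, (3.7)] [cite: SerreTate1968, §1 Lemma 1] -/
theorem range_comp_eq_range_unitComponent_of_natCard_specialFibre_eq_one [Finite (𝟙_ (Over (Spec (.of R))) ⟶ G₀)]
    (hcard : Nat.card (𝟙_ (Over (Spec (.of R))) ⟶ C) = Nat.card (𝟙_ (Over (Spec (.of R))) ⟶ G₀)) :
    Set.range (fun s : 𝟙_ (Over (Spec (.of R))) ⟶ C => s ≫ c) = Set.range (fun s₀ : 𝟙_ (Over (Spec (.of R))) ⟶ G₀ => s₀ ≫ j) := by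
  have hsub := range_comp_subset_range_unitComponent_of_natCard_specialFibre_eq_one R G G₀ j hG hj C c h1
  haveI : IsClosedImmersion j.left := hj.2.2.1
  haveI : Mono j := Over.mono_of_mono_left j
  haveI : Mono c := Over.mono_of_mono_left c
  have hinjc : Function.Injective (fun s : 𝟙_ (Over (Spec (.of R))) ⟶ C => s ≫ c) := fun a b hab => (cancel_mono c).mp hab
  have hinjj : Function.Injective (fun s₀ : 𝟙_ (Over (Spec (.of R))) ⟶ G₀ => s₀ ≫ j) := fun a b hab => (cancel_mono j).mp hab
  haveI : Finite (Set.range (fun s₀ : 𝟙_ (Over (Spec (.of R))) ⟶ G₀ => s₀ ≫ j)) := Set.finite_range _ |>.to_subtype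
  refine Set.eq_of_subset_of_ncard_le hsub ?_ (Set.finite_range _)
  rw [Set.ncard_range_of_injective hinjj, Set.ncard_range_of_injective hinjc, hcard]

end Literature.AlgebraicGeometry.GroupSchemes.UnitComponent

end
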